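import Summits.CriticalPhenomena.PercolationContinuityZ3.Theorems.FK.IsingLocalObservableCLT
import Mathlib.Probability.Distributions.Gaussian.Multivariate
import HarnessLib

/-!
# JOINT (MULTIVARIATE) NEWMAN CLT FOR FINITELY MANY LOCAL OBSERVABLES OF A SPIN SYSTEM — E.G. MAGNETISATION AND ENERGY OF
# THE ISING MODEL JOINTLY: `|Λ_n|^{-1/2}(S_n(f_i) − E S_n(f_i))_i ⇒ N(0, Σ)`, `Σ_{ij} = Σ_z Cov(f_i, f_j∘θ_{−z})`

Claimed R42 (8)(c) in the cell INBOX at 2026-08-28T18:14:08Z by fkp-10a gen 355 (NEW CLAIM #2 of the gen), addressed to coordinator fk-4 (next seated gen; (ι) in force for windows); lineage row FO-10a-g355l (self-suggested), package g355-isinglocal, label IM-G.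
Helper file of the `fk-continuity` build cell (bschramm lane; `--supports stmt-CriticalPhenomena-4575`); builds on
p205010 (kernel theorem, internal audit signed; external expert review pending). No definitions, no named facts, no
sorries; standard axioms. UNCONDITIONAL.

Newman 1980, Thm. 2 is a JOINT statement (finitely many block variables; Ellis 2006 note V.5 «convergence to independent
Gaussians as the hypercubes …»). Here the joint law of finitely many local observables `f_i` (`i ∈ κ`, common finite
window `D`) under a positively associated translation-invariant spin measure with summable truncated two-point
function: Cramér–Wold through Mathlib's finite-dimensional Lévy continuity theorem
(`ProbabilityMeasure.tendsto_iff_tendsto_charFun` on `EuclideanSpace ℝ κ`, `charFun_multivariateGaussian`), exactly as the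
tree's random-cluster file `JointLocalObservableCLT` (gen 354, JM-A), with the one-dimensional input the dominated
Newman CLT for the local observable `g_t = Σ_i t_i f_i` (`IsingLocalObservableCLT`).

* `tendsto_charFun_localObservable_of_summable` — characteristic-function form of the generic local-observable CLT.
* `abs_cov_localObservables_shift_le`, `summable_cov_localObservables_shift` — cross covariances `Cov(f, g∘θ_{−z})` of two
  local observables are dominated by those of the local magnetisation, hence summable.
* `cov_linComb_localObservables_shift_eq`, `dotProduct_spinCovMatrix_mulVec_eq` — `t ⬝ Σ t = Σ_z Cov(g_t, g_t∘θ_{−z})`.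
* `posSemidef_spinCovMatrix` — `Σ` is positive semidefinite (symmetric by translation invariance, `t ⬝ Σ t ≥ 0`).
* **`tendstoInDistribution_localObservables_joint_of_summable`** — GENERIC joint CLT;
  **`tendstoInDistribution_localObservables_joint_free_of_lt_criticalBeta`** — the free Ising state, `d ≥ 2`,
  `0 ≤ β < β_c(d)` (e.g. magnetisation and energy jointly Gaussian, asymptotically).

## References

* C. M. Newman, Comm. Math. Phys. 74 (1980) 119–128, Thm. 2; Comm. Math. Phys. 91 (1983) 75–80. [Newman1980]
* R. S. Ellis, *Entropy, Large Deviations, and Statistical Mechanics*, Springer 2006, §V.7 and note 5. [Ellis2006]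
-/

noncomputable section

namespace Summit.CriticalPhenomena.PercolationContinuityZ3.Theorems.FK

namespace IsingCLT

open MeasureTheory ProbabilityTheory Filter Topology Finset Complex Matrix
open scoped RealInnerProductSpace
open Literature.Probability.Percolation Literature.Probability.LatticeModels
open Summit.CriticalPhenomena.PercolationContinuityZ3.Theorems.FK.NewmanCLT

variable {d : ℕ}

/-! ### The characteristic-function form of the local-observable CLT -/

/-- **Newman's CLT for a local observable, characteristic-function form** (generic): under the hypotheses of
`tendstoInDistribution_localObservable_of_summable`, for every real `s`:
`E_μ exp(is(S_n(f) − E S_n(f))/√|Λ_n|) → exp(−σ_f² s²/2)`, `σ_f² = Σ_z Cov_μ(f, f∘θ_{−z})`.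
[cite: Newman1980, Thm. 2 and remark after (12)] -/
theorem tendsto_charFun_localObservable_of_summable {μ : Measure (SpinConfig (Site d))} [IsProbabilityMeasure μ]
    (hd : 1 ≤ d) (hPA : IsPositivelyAssociated μ) (hμ : IsTranslationInvariantMeasure μ)
    (hsum : Summable fun z : Site d => cov[spinAt 0, spinAt z; μ]) {f : SpinConfig (Site d) → ℝ}
    {D : Finset (Site d)} (hf : DependsOn f (↑D : Set (Site d))) (s : ℝ) :
    Tendsto (fun n : ℕ => ∫ σ, cexp ((((s / Real.sqrt #(box d n)) *
        (∑ z ∈ box d n, f (configShift (-z) σ) - ∫ σ', ∑ z ∈ box d n, f (configShift (-z) σ') ∂μ) : ℝ) : ℂ) * I) ∂μ)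
      atTop (𝓝 ((Real.exp (-((∑' z : Site d, cov[f, fun σ => f (configShift (-z) σ); μ]) * s ^ 2 / 2)) : ℝ) : ℂ)) := by
  classical
  have hfm : Measurable f := hf.measurable_of_finset D
  obtain ⟨B, hB⟩ := hf.exists_bound_of_finset D
  have hB0 : 0 ≤ B := (abs_nonneg _).trans (hB 1)
  have hXm : ∀ z : Site d, Measurable fun σ : SpinConfig (Site d) => f (configShift (-z) σ) := fun z =>
    hfm.comp (configShift (-z)).measurable
  have hXdm : ∀ z : Site d, Measurable fun σ : SpinConfig (Site d) => B * ∑ a ∈ D, spinAt a (configShift (-z) σ) :=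
    fun z => (measurable_mul_sum_spinAt B D).comp (configShift (-z)).measurable
  have hcov : ∀ x y : Site d, cov[(fun (z : Site d) (σ : SpinConfig (Site d)) => f (configShift (-z) σ)) x,
      (fun (z : Site d) (σ : SpinConfig (Site d)) => f (configShift (-z) σ)) y; μ] =
      (fun z : Site d => cov[f, fun σ => f (configShift (-z) σ); μ]) (y - x) :=
    fun x y => covariance_comp_configShift_eq hμ f f x y
  have hcovd : ∀ x y : Site d,
      cov[(fun (z : Site d) (σ : SpinConfig (Site d)) => B * ∑ a ∈ D, spinAt a (configShift (-z) σ)) x,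
        (fun (z : Site d) (σ : SpinConfig (Site d)) => B * ∑ a ∈ D, spinAt a (configShift (-z) σ)) y; μ] =
      (fun z : Site d => cov[fun σ => B * ∑ a ∈ D, spinAt a σ,
        fun σ => B * ∑ b ∈ D, spinAt b (configShift (-z) σ); μ]) (y - x) :=
    fun x y => covariance_comp_configShift_eq hμ (fun σ => B * ∑ a ∈ D, spinAt a σ)
      (fun σ => B * ∑ a ∈ D, spinAt a σ) x y
  have hmono : ∀ z : Site d, Monotone (configShift (S := ℤˣ) (-z)) := fun z => configShift_monotone (-z)
  have hdom : ∀ z : Site d, ∀ ⦃σ σ' : SpinConfig (Site d)⦄, σ ≤ σ' →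
      |(fun (z : Site d) (σ : SpinConfig (Site d)) => f (configShift (-z) σ)) z σ' -
          (fun (z : Site d) (σ : SpinConfig (Site d)) => f (configShift (-z) σ)) z σ| ≤
        (fun (z : Site d) (σ : SpinConfig (Site d)) => B * ∑ a ∈ D, spinAt a (configShift (-z) σ)) z σ' -
          (fun (z : Site d) (σ : SpinConfig (Site d)) => B * ∑ a ∈ D, spinAt a (configShift (-z) σ)) z σ :=
    fun z σ σ' h => abs_sub_le_of_dependsOn hf hB (hmono z h)
  exact tendsto_charFun_boxSum_of_dominated hd hPA hXm hB0 (fun z σ => hB _) hcov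
    (summable_cov_localObservable_shift hPA hμ hsum hf) hXdm (fun z σ => abs_mul_sum_spinAt_le hB0 D _) hcovd
    (summable_cov_sum_spinAt_shift hμ hsum B D) hdom s

/-! ### Cross covariances of two local observables -/

section Cov

variable {μ : Measure (SpinConfig (Site d))} [IsProbabilityMeasure μ]

/-- **Cross covariances are dominated** (Newman 1980, (12)): for `f, g` depending on the spins in `D` with `|f|, |g| ≤ C`
and a positively associated `μ`: `|Cov(f, g∘θ_{−z})| ≤ Cov(CΣ_{x∈D}σ_x, (CΣ_{x∈D}σ_x)∘θ_{−z})`. [cite: Newman1980, (12)] -/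
theorem abs_cov_localObservables_shift_le (hPA : IsPositivelyAssociated μ) {f g : SpinConfig (Site d) → ℝ}
    {D : Finset (Site d)} (hf : DependsOn f (↑D : Set (Site d))) (hg : DependsOn g (↑D : Set (Site d)))
    (hfm : Measurable f) (hgm : Measurable g) {C : ℝ} (hfC : ∀ σ, |f σ| ≤ C) (hgC : ∀ σ, |g σ| ≤ C) (z : Site d) :
    |cov[f, fun σ => g (configShift (-z) σ); μ]| ≤
      cov[fun σ => C * ∑ a ∈ D, spinAt a σ, fun σ => C * ∑ b ∈ D, spinAt b (configShift (-z) σ); μ] := by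
  have hC0 : 0 ≤ C := (abs_nonneg _).trans (hfC 1)
  have hdomf : ∀ ⦃σ σ' : SpinConfig (Site d)⦄, σ ≤ σ' →
      |f σ' - f σ| ≤ C * ∑ x ∈ D, spinAt x σ' - C * ∑ x ∈ D, spinAt x σ := abs_sub_le_of_dependsOn hf hfC
  have hdomg : ∀ ⦃σ σ' : SpinConfig (Site d)⦄, σ ≤ σ' →
      |g σ' - g σ| ≤ C * ∑ x ∈ D, spinAt x σ' - C * ∑ x ∈ D, spinAt x σ := abs_sub_le_of_dependsOn hg hgC
  have hmono : Monotone (configShift (S := ℤˣ) (-z)) := configShift_monotone (-z)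
  have hdomgz : ∀ ⦃σ σ' : SpinConfig (Site d)⦄, σ ≤ σ' →
      |g (configShift (-z) σ') - g (configShift (-z) σ)| ≤
        C * ∑ x ∈ D, spinAt x (configShift (-z) σ') - C * ∑ x ∈ D, spinAt x (configShift (-z) σ) :=
    fun σ σ' h => hdomg (hmono h)
  have hid : ∀ a b : ℝ, |id a - id b| ≤ |a - b| := fun a b => le_rfl
  refine abs_covariance_le_covariance_of_dominated hPA hfm (hgm.comp (configShift (-z)).measurable)
    (measurable_mul_sum_spinAt C D) ((measurable_mul_sum_spinAt C D).comp (configShift (-z)).measurable)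
    ⟨C, hfC⟩ ⟨C, fun σ => hgC _⟩ ⟨C * #D, abs_mul_sum_spinAt_le hC0 D⟩ ⟨C * #D, fun σ => abs_mul_sum_spinAt_le hC0 D _⟩
    ?_ ?_ ?_ ?_
  · exact monotone_add_comp_of_dominated hdomf hid
  · exact monotone_sub_comp_of_dominated hdomf hid
  · exact monotone_add_comp_of_dominated hdomgz hid
  · exact monotone_sub_comp_of_dominated hdomgz hid

/-- **Summable cross covariances**: for two observables `f, g` of the spins in `D` under a positively associated
translation-invariant measure with `Σ_z Cov(σ_0,σ_z) < ∞`, `z ↦ Cov(f, g∘θ_{−z})` is summable. [cite: Newman1980, (12) and Thm. 2 (D)] -/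
theorem summable_cov_localObservables_shift (hPA : IsPositivelyAssociated μ) (hμ : IsTranslationInvariantMeasure μ)
    (hsum : Summable fun z : Site d => cov[spinAt 0, spinAt z; μ]) {f g : SpinConfig (Site d) → ℝ}
    {D : Finset (Site d)} (hf : DependsOn f (↑D : Set (Site d))) (hg : DependsOn g (↑D : Set (Site d))) :
    Summable fun z : Site d => cov[f, fun σ => g (configShift (-z) σ); μ] := by
  classical
  have hfm : Measurable f := hf.measurable_of_finset D
  have hgm : Measurable g := hg.measurable_of_finset D
  obtain ⟨Bf, hBf⟩ := hf.exists_bound_of_finset D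
  obtain ⟨Bg, hBg⟩ := hg.exists_bound_of_finset D
  have hfC : ∀ σ, |f σ| ≤ max Bf Bg := fun σ => (hBf σ).trans (le_max_left _ _)
  have hgC : ∀ σ, |g σ| ≤ max Bf Bg := fun σ => (hBg σ).trans (le_max_right _ _)
  refine Summable.of_norm_bounded (summable_cov_sum_spinAt_shift hμ hsum (max Bf Bg) D) fun z => ?_
  rw [Real.norm_eq_abs]
  exact abs_cov_localObservables_shift_le hPA hf hg hfm hgm hfC hgC z

/-- A finite linear combination of observables of the spins in `D` depends only on the spins in `D`. [folklore] -/
theorem dependsOn_linComb {κ : Type*} [Fintype κ] {f : κ → SpinConfig (Site d) → ℝ} {D : Finset (Site d)}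
    (hf : ∀ i, DependsOn (f i) (↑D : Set (Site d))) (t : κ → ℝ) :
    DependsOn (fun σ => ∑ i, t i * f i σ) (↑D : Set (Site d)) :=
  fun σ τ h => Finset.sum_congr rfl fun i _ => by rw [hf i h]

/-- **Bilinearity along a linear combination**: for `g_t = Σ_i t_i f_i`,
`Cov(g_t, g_t∘θ_{−z}) = Σ_{i,j} t_i t_j Cov(f_i, f_j∘θ_{−z})`. [folklore] -/
theorem cov_linComb_localObservables_shift_eq {κ : Type*} [Fintype κ] {f : κ → SpinConfig (Site d) → ℝ}
    {D : Finset (Site d)} (hf : ∀ i, DependsOn (f i) (↑D : Set (Site d))) (t : κ → ℝ) (z : Site d) :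
    cov[fun σ => ∑ i, t i * f i σ, fun σ => ∑ j, t j * f j (configShift (-z) σ); μ] =
      ∑ i, ∑ j, t i * t j * cov[f i, fun σ => f j (configShift (-z) σ); μ] := by
  classical
  have hfm : ∀ i, Measurable (f i) := fun i => (hf i).measurable_of_finset D
  have hfb : ∀ i, ∃ C, ∀ σ, |f i σ| ≤ C := fun i => (hf i).exists_bound_of_finset D
  have hm1 : ∀ i ∈ (Finset.univ : Finset κ), MemLp (fun σ => t i * f i σ) 2 μ := fun i _ => by
    obtain ⟨C, hC⟩ := hfb i
    exact (memLp_of_abs_le (hfm i) hC 2).const_mul _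
  have hm2 : ∀ j ∈ (Finset.univ : Finset κ), MemLp (fun σ => t j * f j (configShift (-z) σ)) 2 μ := fun j _ => by
    obtain ⟨C, hC⟩ := hfb j
    exact (memLp_of_abs_le ((hfm j).comp (configShift (-z)).measurable) (fun σ => hC _) 2).const_mul _
  rw [covariance_fun_sum_fun_sum' hm1 hm2]
  refine Finset.sum_congr rfl fun i _ => Finset.sum_congr rfl fun j _ => ?_
  rw [covariance_const_mul_left, covariance_const_mul_right, mul_assoc]

/-- **The quadratic form of the covariance matrix**: with `Σ_{ij} = Σ_z Cov(f_i, f_j∘θ_{−z})`,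
`t ⬝ Σ t = Σ_z Cov(g_t, g_t∘θ_{−z})`, `g_t = Σ_i t_i f_i`. [cite: Newman1980, Thm. 2 (D); Ellis2006, Lemma V.7.1] -/
theorem dotProduct_spinCovMatrix_mulVec_eq {κ : Type*} [Fintype κ] (hPA : IsPositivelyAssociated μ)
    (hμ : IsTranslationInvariantMeasure μ) (hsum : Summable fun z : Site d => cov[spinAt 0, spinAt z; μ])
    {f : κ → SpinConfig (Site d) → ℝ} {D : Finset (Site d)} (hf : ∀ i, DependsOn (f i) (↑D : Set (Site d)))
    {S : Matrix κ κ ℝ} (hS : ∀ i j, S i j = ∑' z : Site d, cov[f i, fun σ => f j (configShift (-z) σ); μ]) (t : κ → ℝ) :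
    t ⬝ᵥ S *ᵥ t = ∑' z : Site d, cov[fun σ => ∑ i, t i * f i σ, fun σ => ∑ j, t j * f j (configShift (-z) σ); μ] := by
  have hs : ∀ i j, Summable fun z : Site d => cov[f i, fun σ => f j (configShift (-z) σ); μ] :=
    fun i j => summable_cov_localObservables_shift hPA hμ hsum (hf i) (hf j)
  simp_rw [cov_linComb_localObservables_shift_eq hf t]
  rw [Summable.tsum_finsetSum (fun i _ => summable_sum fun j _ => (hs i j).mul_left _)]
  simp_rw [Summable.tsum_finsetSum (fun j _ => (hs _ j).mul_left _), (hs _ _).tsum_mul_left, ← hS]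
  simp only [dotProduct, Matrix.mulVec, Finset.mul_sum]
  refine Finset.sum_congr rfl fun i _ => Finset.sum_congr rfl fun j _ => ?_
  ring

/-- **The covariance matrix `Σ_{ij} = Σ_z Cov_μ(f_i, f_j∘θ_{−z})` of finitely many local observables is positive
semidefinite**: symmetric by translation invariance (`Cov(f_j, f_i∘θ_{−z}) = Cov(f_i, f_j∘θ_{z})`, reindex `z ↦ −z`) and
`t ⬝ Σ t = Σ_z Cov(g_t, g_t∘θ_{−z}) ≥ 0` (`tsum_cov_localObservable_shift_nonneg`).
[cite: Newman1980, Thm. 2 (D); Ellis2006, Lemma V.7.1] -/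
theorem posSemidef_spinCovMatrix {κ : Type*} [Fintype κ] (hPA : IsPositivelyAssociated μ)
    (hμ : IsTranslationInvariantMeasure μ) (hsum : Summable fun z : Site d => cov[spinAt 0, spinAt z; μ])
    {f : κ → SpinConfig (Site d) → ℝ} {D : Finset (Site d)} (hf : ∀ i, DependsOn (f i) (↑D : Set (Site d)))
    {S : Matrix κ κ ℝ} (hS : ∀ i j, S i j = ∑' z : Site d, cov[f i, fun σ => f j (configShift (-z) σ); μ]) :
    S.PosSemidef := by
  refine Matrix.PosSemidef.of_dotProduct_mulVec_nonneg ?_ fun t => ?_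
  · -- symmetry
    refine Matrix.IsHermitian.ext fun i j => ?_
    rw [star_trivial, hS, hS]
    symm
    rw [← (Equiv.neg (Site d)).tsum_eq]
    refine tsum_congr fun z => ?_
    rw [Equiv.neg_apply]
    conv_rhs => rw [covariance_comm]
    have h := covariance_comp_configShift_eq hμ (f i) (f j) z 0
    simp only [neg_zero, configShift_zero, zero_sub] at h
    exact h.symm
  · -- nonnegativity of the quadratic form
    rw [star_trivial, dotProduct_spinCovMatrix_mulVec_eq hPA hμ hsum hf hS t]
    exact tsum_cov_localObservable_shift_nonneg hPA hμ hsum (dependsOn_linComb hf t)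

end Cov

/-! ### The joint central limit theorem -/

/-- **JOINT NEWMAN CLT FOR FINITELY MANY LOCAL OBSERVABLES OF A SPIN SYSTEM, generic**: `μ` positively associated,
translation invariant, `Σ_z Cov_μ(σ_0,σ_z) < ∞` (`d ≥ 1`); `f_i` (`i ∈ κ` finite) observables of the spins in a finite
window `D`; `Σ_{ij} = Σ_z Cov_μ(f_i, f_j∘θ_{−z})` (positive semidefinite, `posSemidef_spinCovMatrix`). Then the random
VECTOR `V_n = |Λ_n|^{-1/2}(S_n(f_i) − E_μ S_n(f_i))_{i∈κ}`, `S_n(f) = Σ_{z∈Λ_n} f∘θ_{−z}`, converges in distribution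
to the centred Gaussian vector `N(0, Σ)` on `ℝ^κ` (`multivariateGaussian 0 Σ` on `EuclideanSpace ℝ κ`) — Cramér–Wold
through the finite-dimensional Lévy theorem, the scalar input being `tendsto_charFun_localObservable_of_summable` for
`g_t = Σ_i t_i f_i`. [cite: Newman1980, Thm. 2; Ellis2006, Thm. V.7.2] -/
theorem tendstoInDistribution_localObservables_joint_of_summable {Ω' : Type*} {mΩ' : MeasurableSpace Ω'}
    {P' : Measure Ω'} [IsProbabilityMeasure P'] {κ : Type*} [Fintype κ] [DecidableEq κ]
    {Z : Ω' → EuclideanSpace ℝ κ} {μ : Measure (SpinConfig (Site d))} [IsProbabilityMeasure μ] (hd : 1 ≤ d)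
    (hPA : IsPositivelyAssociated μ) (hμ : IsTranslationInvariantMeasure μ)
    (hsum : Summable fun z : Site d => cov[spinAt 0, spinAt z; μ]) {f : κ → SpinConfig (Site d) → ℝ}
    {D : Finset (Site d)} (hf : ∀ i, DependsOn (f i) (↑D : Set (Site d))) {S : Matrix κ κ ℝ}
    (hS : ∀ i j, S i j = ∑' z : Site d, cov[f i, fun σ => f j (configShift (-z) σ); μ])
    (hZ : HasLaw Z (multivariateGaussian 0 S) P') :
    TendstoInDistribution (fun (n : ℕ) (σ : SpinConfig (Site d)) =>
        (WithLp.toLp 2 fun i : κ => (Real.sqrt #(box d n))⁻¹ *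
          (∑ z ∈ box d n, f i (configShift (-z) σ) - ∫ σ', ∑ z ∈ box d n, f i (configShift (-z) σ') ∂μ) :
          EuclideanSpace ℝ κ)) atTop Z (fun _ => μ) P' := by
  classical
  have hfm : ∀ i, Measurable (f i) := fun i => (hf i).measurable_of_finset D
  have hfb : ∀ i, ∃ C, ∀ σ, |f i σ| ≤ C := fun i => (hf i).exists_bound_of_finset D
  have hSm : ∀ (i : κ) (n : ℕ), Measurable fun σ : SpinConfig (Site d) => ∑ z ∈ box d n, f i (configShift (-z) σ) :=
    fun i n => Finset.measurable_sum _ fun z _ => (hfm i).comp (configShift (-z)).measurable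
  have hSint : ∀ (i : κ) (n : ℕ), Integrable (fun σ : SpinConfig (Site d) => ∑ z ∈ box d n, f i (configShift (-z) σ)) μ := by
    intro i n
    obtain ⟨C, hC⟩ := hfb i
    exact memLp_one_iff_integrable.1 (memLp_of_abs_le (hSm i n)
      (fun σ => (Finset.abs_sum_le_sum_abs _ _).trans (Finset.sum_le_sum fun z _ => hC _)) 1)
  have hVm : ∀ n : ℕ, Measurable fun σ : SpinConfig (Site d) =>
      (WithLp.toLp 2 fun i : κ => (Real.sqrt #(box d n))⁻¹ *
        (∑ z ∈ box d n, f i (configShift (-z) σ) - ∫ σ', ∑ z ∈ box d n, f i (configShift (-z) σ') ∂μ) :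
        EuclideanSpace ℝ κ) :=
    fun n => (WithLp.measurable_toLp (p := 2) (X := κ → ℝ)).comp
      (measurable_pi_lambda _ fun i => ((hSm i n).sub_const _).const_mul _)
  refine ⟨fun n => (hVm n).aemeasurable, hZ.aemeasurable, ?_⟩
  refine ProbabilityMeasure.tendsto_iff_tendsto_charFun.2 fun t => ?_
  rw! [hZ.map_eq]
  simp only [ProbabilityMeasure.coe_mk]
  have hσ : t.ofLp ⬝ᵥ S *ᵥ t.ofLp =
      ∑' z : Site d, cov[fun σ => ∑ i, t.ofLp i * f i σ, fun σ => ∑ j, t.ofLp j * f j (configShift (-z) σ); μ] :=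
    dotProduct_spinCovMatrix_mulVec_eq hPA hμ hsum hf hS t.ofLp
  rw [charFun_multivariateGaussian (posSemidef_spinCovMatrix hPA hμ hsum hf hS), inner_zero_right, hσ,
    Complex.ofReal_zero, show ∀ σ : ℝ, cexp (0 * I - (σ : ℂ) / 2) = ((Real.exp (-(σ * (1 : ℝ) ^ 2 / 2)) : ℝ) : ℂ) from fun σ => by
      rw [Complex.ofReal_exp]; congr 1; push_cast; ring]
  have key := tendsto_charFun_localObservable_of_summable hd hPA hμ hsum (dependsOn_linComb hf t.ofLp) 1
  refine key.congr fun n => ?_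
  -- identify the scalar characteristic function of `⟨V_n, t⟩` with that of `S_n(g_t)`
  have hlinS : ∀ σ : SpinConfig (Site d), ∑ z ∈ box d n, ∑ i, t.ofLp i * f i (configShift (-z) σ) =
      ∑ i, t.ofLp i * ∑ z ∈ box d n, f i (configShift (-z) σ) := by
    intro σ
    rw [Finset.sum_comm]
    simp_rw [Finset.mul_sum]
  have hint : ∫ σ', ∑ z ∈ box d n, ∑ i, t.ofLp i * f i (configShift (-z) σ') ∂μ =
      ∑ i, t.ofLp i * ∫ σ', ∑ z ∈ box d n, f i (configShift (-z) σ') ∂μ := by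
    simp_rw [hlinS]
    rw [integral_finsetSum _ (fun i _ => (hSint i n).const_mul _)]
    simp_rw [integral_const_mul]
  rw [charFun_apply, integral_map (hVm n).aemeasurable (by fun_prop)]
  refine integral_congr_ae (ae_of_all _ fun σ => ?_)
  simp only [hlinS σ, hint, PiLp.inner_apply, RCLike.inner_apply, conj_trivial]
  congr 1
  push_cast
  rw [← Finset.sum_sub_distrib, Finset.mul_sum]
  exact congrArg (· * I) (Finset.sum_congr rfl fun i _ => by ring)

/-- **JOINT CLT FOR FINITELY MANY LOCAL OBSERVABLES OF THE ISING MODEL BELOW `β_c`** (e.g. the magnetisation density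
`σ_0` and the energy density `Σ_i σ_0σ_{e_i}` JOINTLY; Newman 1980 Thm. 2 with sharpness; UNCONDITIONAL): for `d ≥ 2`,
`0 ≤ β < β_c(d)`, the free state `μ` at zero field and local `f_i`, `i ∈ κ`:
`|Λ_n|^{-1/2}(S_n(f_i) − E S_n(f_i))_i ⇒ N(0, Σ)`, `Σ_{ij} = Σ_z Cov^∅_β(f_i, f_j∘θ_{−z})`.
[cite: Newman1980, Thm. 2; Ellis2006, Thm. V.7.2; AizenmanBarskyFernandezJSP1987, Thm. 1] -/
theorem tendstoInDistribution_localObservables_joint_free_of_lt_criticalBeta {Ω' : Type*} {mΩ' : MeasurableSpace Ω'}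
    {P' : Measure Ω'} [IsProbabilityMeasure P'] {κ : Type*} [Fintype κ] [DecidableEq κ]
    {Z : Ω' → EuclideanSpace ℝ κ} (hd : 2 ≤ d) {β : ℝ} (hβ : 0 ≤ β) (hβc : β < criticalBeta d)
    (μ : Measure (SpinConfig (Site d))) [IsProbabilityMeasure μ]
    (hμ : ∀ A : Finset (Site d), spinCorr μ A = freeCorr d β 0 A) {f : κ → SpinConfig (Site d) → ℝ}
    {D : Finset (Site d)} (hf : ∀ i, DependsOn (f i) (↑D : Set (Site d))) {S : Matrix κ κ ℝ}
    (hS : ∀ i j, S i j = ∑' z : Site d, cov[f i, fun σ => f j (configShift (-z) σ); μ])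
    (hZ : HasLaw Z (multivariateGaussian 0 S) P') :
    TendstoInDistribution (fun (n : ℕ) (σ : SpinConfig (Site d)) =>
        (WithLp.toLp 2 fun i : κ => (Real.sqrt #(box d n))⁻¹ *
          (∑ z ∈ box d n, f i (configShift (-z) σ) - ∫ σ', ∑ z ∈ box d n, f i (configShift (-z) σ') ∂μ) :
          EuclideanSpace ℝ κ)) atTop Z (fun _ => μ) P' := by
  have hT := isTranslationInvariantMeasure_of_spinCorr_eq_freeCorr hβ le_rfl μ hμ
  have hsum : Summable fun z : Site d => cov[spinAt 0, spinAt z; μ] := by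
    simp_rw [covariance_spinAt_eq_twoPointFree hβ hμ, sub_zero]
    exact summable_twoPointFree_of_lt_criticalBeta hd hβ hβc
  exact tendstoInDistribution_localObservables_joint_of_summable (le_trans one_le_two hd)
    (isPositivelyAssociated_of_spinCorr_eq_freeCorr hβ le_rfl μ hμ) hT hsum hf hS hZ

end IsingCLT

end Summit.CriticalPhenomena.PercolationContinuityZ3.Theorems.FK

end
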